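import Literature.NumberTheory.EllipticCurves.Sprung2024.ChromaticSmallControlSurjProofs
import Literature.NumberTheory.EllipticCurves.Sprung2012.ColemanTwistProofs
import HarnessLib

/-!
# Sprung 2012 Def. 7.2 / §7.1: the values of the JOINT Coleman map modulo `T` — `L♭(0) = −(a_p − 2)·z(c₋₁)`,
# `L♯(0) = −(a_p(a_p − 2) − (p − 1))·z(c₋₁)`; hence `Col = (Col♯, Col♭) : H¹_Iw(T) → Λ²` is NOT surjective (its image
# mod `T` is the line spanned by `(a_p(a_p−2) − (p−1), a_p − 2)`) — proofs only, in the tree's functional model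

Topic `Literature/NumberTheory/EllipticCurves`, cluster `Sprung2012` (namespace = path). THEOREMS only (no definition, no named
fact; net Literature debt `0`). Cell `bsd-ssimc`, width seat `cruxlead-stmt-BirchSwinnertonDyer-19875-w3` (gen 6), companion of
`ColemanMapJointInjectiveProofs.lean` (injectivity of the joint map). The «SANITY» remark of `ColemanMapImage.lean` («the joint
map `(Col♯, Col♭)` is NOT surjective; in the transcription its image mod `T` is the line spanned by
`(a_p(a_p−2)−(p−1), a_p−2)·z(c₋₁)`, by the levels `0, 1` of `IsColemanPair` and Thm. 2.2») as kernel theorems: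

* `IsColemanPair.constantCoeff_flat` — level `0` of `IsColemanPair` (Def. 7.2: `Col♭_0 = −P¹_0`; `(u_0, v_0) = (0, 1)`, `ω_0 = T`):
  `L♭(0) = −z(c_0) = −(a_p − 2)·z(c₋₁)` (Honda relation `c_0 = (a_p − 2)c₋₁`).
* `IsColemanPair.constantCoeff_sharp` — level `1` (Def. 7.2: `Col♯_1 = −P¹_1`; `(u_1, v_1) = (1, 0)`, `ω_1(0) = 0`):
  `L♯(0) = −∑_{j<p} z(gʲc_1) = −z(Tr_{1/0} c_1) = −(a_p(a_p − 2) − (p − 1))·z(c₋₁)` (Honda relation for `Tr_{1/0} c_1`).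
* `IsColemanPair.constantCoeff_relation` — `(a_p − 2)·L♯(0) = (a_p(a_p−2) − (p−1))·L♭(0)` for EVERY Coleman value: the
  image of the joint Coleman map reduces mod `T` into a LINE; `IsColemanPair.not_pair_one_zero` — no functional has Coleman
  value `(1, 0)` when `a_p ≠ 2` (odd supersingular `p`): the joint map is not onto, its cokernel surjects onto `Λ/(T)`.
WHY (crux stmt-BirchSwinnertonDyer-22569 / 22901, ledger doors p648498 / p651820, skeleton p652444): the cokernel bound F-α needs
`ℓ_𝔭(coker (Col♯, Col♭)) = 0`, available at every height-one `𝔭 ≠ (T)` (Kurihara–Pollack / Lei–Sujatha (SES-KP): cokernel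
`= Λ/(T)`); this file certifies the complementary fact that AT `𝔭 = (T)` the hypothesis FAILS — the ledger door cannot reach
the stub S4b-T (`𝔭 = (T)`, `r_an ≥ 2`), consistently with the skeleton's binders. The cokernel EQUALITY `= Λ/(T)` (i.e.
`T·Λ² ⊆ image`) is NOT proved here. Nothing about any curve's Selmer group or BSD is asserted.

References: [Sprung2012] Thm. 2.2 (p. 1487), Def. 3.1 (p. 1489), Def. 5.9 (p. 1495), Def. 7.1–7.2, Prop. 7.3 (p. 1500), Prop. 7.6
(p. 1501); [KuriharaPollack2007] Prop. 1.2; [LeiSujatha2021] §3 (SES-KP); tree: `Sprung2012/ColemanMaps.lean` (`IsHondaSystem`,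
`IsColemanPair`), `ColemanMapImage.lean` (module docstring SANITY), `Sprung2024/ChromaticSmallControlSurjProofs.lean`
(`constantCoeff_toIwasawa_cyclotomicOmega`, `constantCoeff_pairingSum`; the same level-0/1 computation inside
`colemanKer_apply_eq_zero_of_mem_localLayerPointsOfEmb_zero`), `LocalTowerTraceProofs.lean` (`localTraceOfEmb_succ_eq_sum_pow_smul`),
`Sprung2017/SharpFlatPAdicLFunction.lean` (`sharpPoly_zero/one`, `flatPoly_zero/one`).
-/

noncomputable section

open scoped Classical NumberField

open NumberField IsDedekindDomain Polynomial WeierstrassCurve Literature.NumberTheory.EllipticCurves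
  Literature.NumberTheory.EllipticCurves.ZpExtension Literature.NumberTheory.EllipticCurves.Sprung2017
  Literature.NumberTheory.EllipticCurves.Kobayashi2003

universe u

namespace Literature.NumberTheory.EllipticCurves.Sprung2012

section ModT

variable {K : Type u} [Field K] {p : ℕ} [Fact p.Prime] {κ : ZpExtension K p}
variable {E : Type u} [Field E] [Algebra K E] {ι : AlgebraicClosure K →ₐ[K] AlgebraicClosure E}
variable {W : WeierstrassCurve K}

/-- A functional on a subgroup evaluates additively over finite sums of members (plumbing). [folklore] -/
private theorem evalOn_finset_sum (A : AddSubgroup (localPoints W E)) (z : A →+ ℤ_[p]) {α : Type*} (s : Finset α)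
    (P : α → localPoints W E) (hP : ∀ a ∈ s, P a ∈ A) :
    evalOn W A z (∑ a ∈ s, P a) = ∑ a ∈ s, evalOn W A z (P a) := by
  classical
  induction s using Finset.induction_on with
  | empty =>
    rw [Finset.sum_empty, Finset.sum_empty, evalOn_of_mem W A z A.zero_mem]
    exact map_zero z
  | insert a s ha ih =>
    have hPa : P a ∈ A := hP a (Finset.mem_insert_self a s)
    have hs : ∑ b ∈ s, P b ∈ A := A.sum_mem fun b hb => hP b (Finset.mem_insert_of_mem hb)
    rw [Finset.sum_insert ha, Finset.sum_insert ha, evalOn_of_mem W A z (add_mem hPa hs), evalOn_of_mem W A z hPa,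
      ← ih fun b hb => hP b (Finset.mem_insert_of_mem hb), evalOn_of_mem W A z hs, ← map_add]
    rfl

/-- A functional on a subgroup commutes with integer multiples of members (plumbing). [folklore] -/
private theorem evalOn_zsmul (A : AddSubgroup (localPoints W E)) (z : A →+ ℤ_[p]) {P : localPoints W E} (hP : P ∈ A)
    (k : ℤ) : evalOn W A z (k • P) = k • evalOn W A z P := by
  rw [evalOn_of_mem W A z (zsmul_mem hP k), evalOn_of_mem W A z hP, ← map_zsmul]
  rfl

/-- **Level `0` of the Coleman condition: `L♭(0) = −z(c_0) = −(a_p − 2)·z(c₋₁)`** (Sprung Def. 7.2: `Col♭_0 = −P¹_0`; in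
the transcription `ω_0 = T ∣ P_{0,c_0}(z) + 0·L♯ + 1·L♭` and `c_0 = (a_p − 2)c₋₁`).
[cite: Sprung2012, Def. 7.2 (p. 1500), Thm. 2.2 (2) (p. 1487), Def. 5.9 (p. 1495)] -/
theorem IsColemanPair.constantCoeff_flat {ap : ℤ} {g : Field.absoluteGaloisGroup E} {cneg : localPoints W E}
    {c : ℕ → localPoints W E} (hH : IsHondaSystem κ ι W ap g cneg c)
    {z : localTowerPointsOfEmb κ ι W →+ ℤ_[p]} {Lsharp Lflat : IwasawaAlgebra p}
    (hz : IsColemanPair κ ι W ap g c z Lsharp Lflat) :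
    PowerSeries.constantCoeff Lflat = -((ap - 2 : ℤ) • evalOn W (localTowerPointsOfEmb κ ι W) z cneg) := by
  obtain ⟨hcneg, -, hc0, -⟩ := hH
  have hcnegT : cneg ∈ localTowerPointsOfEmb κ ι W := localLayerPointsOfEmb_le_localTowerPointsOfEmb κ ι W 0 hcneg
  have h0 := constantCoeff_eq_zero_of_toIwasawa_cyclotomicOmega_dvd (hz 0)
  rw [map_add, map_add, map_mul, map_mul, sharpPoly_zero, flatPoly_zero, map_zero, map_one, map_zero, zero_mul,
    map_one, one_mul, zero_add, constantCoeff_pairingSum, pow_zero, Finset.sum_range_one, pow_zero, one_smul, hc0,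
    evalOn_zsmul _ z hcnegT] at h0
  linear_combination h0

/-- **Level `1` of the Coleman condition: `L♯(0) = −(a_p(a_p − 2) − (p − 1))·z(c₋₁)`** (Sprung Def. 7.2: `Col♯_1 = −P¹_1`;
in the transcription `ω_1 ∣ P_{1,c_1}(z) + 1·L♯ + 0·L♭`, `ω_1(0) = 0`, `P_{1,c_1}(z)(0) = z(Tr_{1/0} c_1)` and the Honda
relation `Tr_{1/0} c_1 = a_p c_0 − (p−1) c₋₁`, `c_0 = (a_p − 2) c₋₁`). Needs the local generator `g` (the orbit sum IS the trace).
[cite: Sprung2012, Def. 7.2 (p. 1500), Thm. 2.2 (1)–(2) (p. 1487), Def. 3.1 (p. 1489), Def. 5.9 (p. 1495)] -/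
theorem IsColemanPair.constantCoeff_sharp {ap : ℤ} {g : Field.absoluteGaloisGroup E}
    (hg : κ.IsTopGenerator (resGalOfEmb ι g)) {cneg : localPoints W E}
    {c : ℕ → localPoints W E} (hH : IsHondaSystem κ ι W ap g cneg c)
    {z : localTowerPointsOfEmb κ ι W →+ ℤ_[p]} {Lsharp Lflat : IwasawaAlgebra p}
    (hz : IsColemanPair κ ι W ap g c z Lsharp Lflat) :
    PowerSeries.constantCoeff Lsharp =
      -((ap * (ap - 2) - ((p : ℤ) - 1) : ℤ) • evalOn W (localTowerPointsOfEmb κ ι W) z cneg) := by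
  obtain ⟨hcneg, hcn, hc0, hc1, -⟩ := hH
  have hcnegT : cneg ∈ localTowerPointsOfEmb κ ι W := localLayerPointsOfEmb_le_localTowerPointsOfEmb κ ι W 0 hcneg
  have hc0T : c 0 ∈ localTowerPointsOfEmb κ ι W := localLayerPointsOfEmb_le_localTowerPointsOfEmb κ ι W 0 (hcn 0)
  have hc1T : c 1 ∈ localTowerPointsOfEmb κ ι W := localLayerPointsOfEmb_le_localTowerPointsOfEmb κ ι W 1 (hcn 1)
  have h1 := constantCoeff_eq_zero_of_toIwasawa_cyclotomicOmega_dvd (hz 1)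
  -- the orbit sum at level 1 is the trace `Tr_{1/0} c_1`
  have htr : ∑ j ∈ Finset.range (p ^ 1), evalOn W (localTowerPointsOfEmb κ ι W) z (g ^ j • c 1) =
      evalOn W (localTowerPointsOfEmb κ ι W) z (localTraceOfEmb κ ι W 0 1 (c 1)) := by
    rw [localTraceOfEmb_succ_eq_sum_pow_smul κ ι W hg 0 (hcn 1),
      evalOn_finset_sum _ z _ _ (fun i _ => smul_mem_localTowerPointsOfEmb κ ι W _ hc1T), pow_one]
    refine Finset.sum_congr rfl fun i _ => ?_
    rw [pow_zero, one_mul]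
  rw [map_add, map_add, map_mul, map_mul, sharpPoly_one, flatPoly_one, map_one, map_zero, map_one, one_mul, map_zero,
    zero_mul, add_zero, constantCoeff_pairingSum, htr, hc1, hc0, smul_smul] at h1
  have hsub : evalOn W (localTowerPointsOfEmb κ ι W) z ((ap * (ap - 2)) • cneg - ((p : ℤ) - 1) • cneg) =
      (ap * (ap - 2)) • evalOn W (localTowerPointsOfEmb κ ι W) z cneg -
        ((p : ℤ) - 1) • evalOn W (localTowerPointsOfEmb κ ι W) z cneg := by
    rw [← sub_smul, evalOn_zsmul _ z hcnegT, sub_smul]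
  rw [hsub] at h1
  rw [sub_smul]
  linear_combination h1

/-- **THE IMAGE OF THE JOINT COLEMAN MAP MODULO `T` IS A LINE**: for every Coleman value `(L♯, L♭)` of a functional,
`(a_p − 2)·L♯(0) = (a_p(a_p−2) − (p−1))·L♭(0)` — both sides are `−(a_p−2)(a_p(a_p−2)−(p−1))·z(c₋₁)`. (So
`(L♯(0), L♭(0))` is proportional to the fixed vector `(a_p(a_p−2) − (p−1), a_p − 2)`; for `(p, a_p) = (3, 3)` this reads
`L♯(0) = L♭(0)`, for `(3, −3)`: `−5·L♯(0) = 13·L♭(0)`.) [cite: Sprung2012, Def. 7.1–7.2 (p. 1500), Thm. 2.2 (p. 1487)] -/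
theorem IsColemanPair.constantCoeff_relation {ap : ℤ} {g : Field.absoluteGaloisGroup E}
    (hg : κ.IsTopGenerator (resGalOfEmb ι g)) {cneg : localPoints W E}
    {c : ℕ → localPoints W E} (hH : IsHondaSystem κ ι W ap g cneg c)
    {z : localTowerPointsOfEmb κ ι W →+ ℤ_[p]} {Lsharp Lflat : IwasawaAlgebra p}
    (hz : IsColemanPair κ ι W ap g c z Lsharp Lflat) :
    ((ap - 2 : ℤ) : ℤ_[p]) * PowerSeries.constantCoeff Lsharp =
      ((ap * (ap - 2) - ((p : ℤ) - 1) : ℤ) : ℤ_[p]) * PowerSeries.constantCoeff Lflat := by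
  rw [hz.constantCoeff_sharp hg hH, hz.constantCoeff_flat hH, zsmul_eq_mul, zsmul_eq_mul]
  ring

/-- **THE JOINT COLEMAN MAP IS NOT SURJECTIVE**: for `a_p ≠ 2` (e.g. any odd supersingular prime, `p ∣ a_p`), NO functional
on `E(K_∞·K_v)` has Coleman value `(1, 0)` — from `constantCoeff_relation`: `L♭ = 0` forces `z(c₋₁) = 0`, hence `L♯(0) = 0`.
So the cokernel of `(Col♯, Col♭) : H¹_Iw(T) → Λ²` is non-zero and surjects onto `Λ/(T)`; the cokernel hypothesis
«`ℓ_𝔭(Λ²/image) = 0`» of the F-α skeleton is available only OFF `(T)` (where print gives cokernel `= Λ/(T)` exactly).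
[cite: Sprung2012, Def. 7.1–7.2, Prop. 7.3 (p. 1500), Prop. 7.6 (p. 1501)] [cite: KuriharaPollack2007, Prop. 1.2] [cite: LeiSujatha2021, §3 (SES-KP)] -/
theorem IsColemanPair.not_pair_one_zero {ap : ℤ} (hap : ap ≠ 2) {g : Field.absoluteGaloisGroup E}
    (hg : κ.IsTopGenerator (resGalOfEmb ι g)) {cneg : localPoints W E}
    {c : ℕ → localPoints W E} (hH : IsHondaSystem κ ι W ap g cneg c)
    (z : localTowerPointsOfEmb κ ι W →+ ℤ_[p]) : ¬ IsColemanPair κ ι W ap g c z 1 0 := by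
  intro hz
  have hflat := hz.constantCoeff_flat hH
  rw [map_zero, zsmul_eq_mul, eq_comm, neg_eq_zero, mul_eq_zero] at hflat
  have hap' : ((ap - 2 : ℤ) : ℤ_[p]) ≠ 0 := by
    rw [Int.cast_ne_zero]
    exact sub_ne_zero.mpr hap
  have hzc : evalOn W (localTowerPointsOfEmb κ ι W) z cneg = 0 := hflat.resolve_left hap'
  have hsharp := hz.constantCoeff_sharp hg hH
  rw [map_one, hzc, smul_zero, neg_zero] at hsharp
  exact one_ne_zero hsharp

end ModT

end Literature.NumberTheory.EllipticCurves.Sprung2012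

end
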